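import Literature.Computability.QuantumComplexity.EvenSVTOutputSampling
import Literature.Computability.Complexity.MedianOfMeans
import HarnessLib

/-!
# Median boosting of one-sided sketch estimators in a metric (Nemirovski–Yudin selection)

Minsker, *Geometric median and robust estimation in Banach spaces*, Bernoulli 21(4) (2015)
2308–2335 = arXiv:1308.1334, §3 (held arXiv text chunk p. 5 L86–119), recalling the selection
rule of Nemirovski–Yudin (1983) for independent estimators `μ̂₁,…,μ̂_k` of `μ` with
`Pr(‖μ̂_j − μ‖ > ε) ≤ p < ½`:

> Define `μ̃ := μ̂_{j*}`, where `j* := min{ j : ∃ I ⊂ {1,…,k} such that |I| > k/2 and ∀ i ∈ I,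
> ‖μ̂_i − μ̂_j‖ ≤ 2ε }` […]. It is not hard to show that `Pr(‖μ̃ − μ‖ > 3ε) ≤ e^{−kψ(1/2;p)}`.
> **Remark 3.2.** It is possible to modify `μ̃` by choosing `ε_*` to be the smallest `ε > 0` for
> which [the set] is nonempty, and setting `j* := j*(ε_*)` [… the bound] remains valid.

This file types the `ε`-free form (Remark 3.2) over an ARBITRARY symmetric `d : E → E → ℝ` with
the triangle inequality — `d` and its two axioms are explicit arguments rather than a
metric-space structure (Mathlib would give `Fin s → ℝ` the sup norm and the toolbox's matrices
no norm at all, and statement files declare no instances) — in the finite product-weight language of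
the tree's `MedianOfMeans` (count bound `e^{−q/8}` at per-trial failure `≤ ¼`,
`Literature.Computability.Complexity.sum_weight_half_bad_le_exp`, in place of `e^{−kψ(1/2;p)}`),
and runs it over two ONE-SIDED Chebyshev forms of the sample-and-query toolbox:
* §1 `IsCenter d x i` (the print's `j*(ε_*)` is one: `exists_isCenter`) and the deterministic
  core `IsCenter.le_three_mul` (a strict majority within `ε` of `z` forces every centre within
  `3ε`).  §2 `sum_weight_center_far_le_exp` / `_near_ge`: `q` independent trials with per-trial
  mass `{ε < d(estimate, z)} ≤ ¼` ⇒ the centre-selected estimate is within `3ε` of `z` off a set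
  of product mass `≤ e^{−q/8}` (`≤ δ` for `q ≥ 8 ln(1/δ)`), for ANY centre selector.
* §3 the one-sided approximate matrix product `XᵀSᵀSY ≈ XᵀY` of `ApproxMatrixProduct` (rows of
  `X` sampled, `Y` arbitrary; Chebyshev, i.e. a `1/δ` count, in print [DKM06] / CGLLTW §3.2):
  `σ ≥ 4φ‖X‖_F²‖Y‖_F²/ε²` rows per copy, `q ≥ 8 ln(1/δ)` copies ⇒ the Frobenius-centre copy is
  within `3ε` of `XᵀY` with product mass `≥ 1 − δ` (`approx_matrix_product_center`).
  §4 the `u ≈ Rb` step of CGLLTW Theorem 3.4 (`EvenSVTOutputSampling.matVecEst`, sampling from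
  `SQ_{φ_b}(b)` only): `matVecEst_center_near_ge`, and its join with the deterministic error
  propagation `output_error_le` — `output_error_mass_center`: the conclusion of the tree's
  `output_error_mass` (one copy, `σ ≥ φ_b‖R‖_F²‖RᵀM‖_F²/(η²δ')`) at `σ ≥ 36φ_b‖R‖_F²‖RᵀM‖_F²/η²`
  per copy and `q ≥ 8 ln(1/δ')` copies; the selected copy is ONE plain `matVecEst`, so every
  consumer of the sketched form (e.g. `outputWitness`) applies to it verbatim.

**Scope (honest).** (i) Constants `3ε`, `e^{−q/8}` are those of the ¼-Chebyshev + Hoeffding route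
(the print's `C_α`, `ψ(1/2;p)` are sharper; not typed).  (ii) CGLLTW Thm 3.4 reaches `log(1/δ)`
for the even-case `u ≈ Rb` step differently: JOINT sampling from both factors + McDiarmid (its
Prop. "appr-mms" = tree `SubsampledMatrixProduct.approx_matrix_product`, access to BOTH factors via
Lemma 2.14 = tree `sq_sketching`); the present route uses access to ONE factor and keeps the
estimator's form, at the price of `q` copies and the `q²` pairwise distances of the selection
(`O(q²s)` arithmetic for `u ∈ ℝ^s`; NOT sublinear for implicitly represented sketched matrix
products, so §3 speaks of SAMPLE counts only); no query/time model is typed in this file.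
(iii) Errors are Frobenius / `ℓ²` (no operator-norm layer).  (iv) Statements are finite weighted
sums over sample sequences (`iidWeight`); nothing here bears on the status of quantum advantage.
-/

noncomputable section

open scoped Matrix
open Finset

namespace Literature.Computability.QuantumComplexity.SampleQuery

/-! ### §1 Half-radius centres of a finite sample -/

section center

variable {E α : Type*} {q : ℕ}

/-- `nearCount d x a r = #{ j : d a (x j) ≤ r }`, the number of sample points in the closed
`d`-ball of radius `r` about `a`. [cite: Minsker2015, §3 (the index set `I`, `|I| > k/2`, in the
definition of `j*`), held arXiv text chunk p. 5 L95–104] -/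
def nearCount (d : E → E → ℝ) (x : Fin q → E) (a : E) (r : ℝ) : ℕ :=
  (univ.filter fun j : Fin q => d a (x j) ≤ r).card

/-- `nearCount` is monotone in the radius. [folklore] -/
private theorem nearCount_mono (d : E → E → ℝ) (x : Fin q → E) (a : E) {r r' : ℝ} (h : r ≤ r') :
    nearCount d x a r ≤ nearCount d x a r' :=
  card_le_card fun j hj => by
    simp only [mem_filter, mem_univ, true_and] at hj ⊢
    exact hj.trans h

/-- **Half-radius centre.** `x i` is a centre of the sample `x : Fin q → E` for `d` if at every
radius `r` at which SOME sample point has a strict majority of the sample in its closed `r`-ball,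
`x i` has one too.  The print's selector `j*(ε_*)` — the sample point whose strict-majority ball
has the smallest radius (equivalently: smallest median distance to the sample, Hsu–Sabato) — is a
centre (the proof of `exists_isCenter` is that selector), and being a centre is all the `3ε`
argument uses.
[cite: Minsker2015, §3 Remark 3.2 (`j* := j*(ε_*)`), held arXiv text chunk p. 5 L113–116] -/
def IsCenter (d : E → E → ℝ) (x : Fin q → E) (i : Fin q) : Prop :=
  ∀ r : ℝ, (∃ i', q < 2 * nearCount d x (x i') r) → q < 2 * nearCount d x (x i) r

/-- **A centre exists** (`q ≥ 1`): minimise the radius `d (x i') (x j)` over the pairs `(i', j)`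
whose ball `B(x i', d (x i') (x j))` holds a strict majority; the first coordinate of a minimiser
is a centre (no property of `d` is used). [cite: Minsker2015, §3 Remark 3.2 (the smallest `ε`)] -/
theorem exists_isCenter (d : E → E → ℝ) (x : Fin q → E) (hq : 0 < q) : ∃ i, IsCenter d x i := by
  classical
  set T : Finset (Fin q × Fin q) :=
    univ.filter fun p : Fin q × Fin q => q < 2 * nearCount d x (x p.1) (d (x p.1) (x p.2)) with hT
  have i₀ : Fin q := ⟨0, hq⟩
  -- `T` is nonempty: the ball about `x i₀` through its farthest sample point holds everything
  have hne : T.Nonempty := by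
    obtain ⟨j, -, hj⟩ := exists_max_image univ (fun j => d (x i₀) (x j)) ⟨i₀, mem_univ _⟩
    refine ⟨(i₀, j), mem_filter.2 ⟨mem_univ _,
      show q < 2 * nearCount d x (x i₀) (d (x i₀) (x j)) from ?_⟩⟩
    have hall : nearCount d x (x i₀) (d (x i₀) (x j)) = q := by
      unfold nearCount
      rw [filter_true_of_mem fun j' hj' => hj j' hj', card_univ, Fintype.card_fin]
    omega
  obtain ⟨p₀, hp₀, hmin⟩ := exists_min_image T (fun p => d (x p.1) (x p.2)) hne
  refine ⟨p₀.1, fun r ⟨i', hi'⟩ => ?_⟩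
  -- the sample points within `r` of `x i'`: nonempty, `j'` the farthest of them
  have hN : (univ.filter fun j : Fin q => d (x i') (x j) ≤ r).Nonempty := by
    rw [← card_pos]; unfold nearCount at hi'; omega
  obtain ⟨j', hj'N, hj'max⟩ := exists_max_image _ (fun j => d (x i') (x j)) hN
  -- `(i', j')` is admissible, so the minimal radius is `≤ d (x i') (x j') ≤ r`
  have hmem : (i', j') ∈ T := by
    refine mem_filter.2 ⟨mem_univ _, show q < 2 * nearCount d x (x i') (d (x i') (x j')) from ?_⟩
    have hle : nearCount d x (x i') r ≤ nearCount d x (x i') (d (x i') (x j')) :=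
      card_le_card fun j hj => mem_filter.2 ⟨mem_univ _, hj'max j hj⟩
    omega
  have hrad : d (x p₀.1) (x p₀.2) ≤ r := (hmin _ hmem).trans (mem_filter.1 hj'N).2
  exact lt_of_lt_of_le (mem_filter.1 hp₀).2 (Nat.mul_le_mul_left 2 (nearCount_mono d x _ hrad))

/-- **A centre selector exists** (`q ≥ 1` trials, outcomes in `α`, estimates `pt`): a map from
outcome sequences to an index whose estimate is a centre of the `q` estimates (e.g. the print's
`j*(ε_*)`); the boosting theorems hold for EVERY such one. [cite: Minsker2015, §3 Remark 3.2] -/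
theorem exists_centerSelector (d : E → E → ℝ) (pt : α → E) (hq : 0 < q) :
    ∃ sel : (Fin q → α) → Fin q, ∀ ω, IsCenter d (fun i => pt (ω i)) (sel ω) :=
  ⟨fun ω => (exists_isCenter d (fun i => pt (ω i)) hq).choose,
    fun ω => (exists_isCenter d (fun i => pt (ω i)) hq).choose_spec⟩

/-- **The `3ε` lemma (deterministic core of the selection).**  For `d` symmetric with the
triangle inequality: if a strict majority of the sample lies within `ε` of `z`, every centre
`x i` has `d (x i) z ≤ 3ε` — a good point `x j₀` sees the whole good majority within `2ε`, so the
centre has a strict majority within `2ε`, and two strict majorities of `Fin q` share a point,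
within `2ε` of `x i` and within `ε` of `z`. [cite: Minsker2015, §3 ("It is not hard to show that
`Pr(‖μ̃ − μ‖ > 3ε) ≤ e^{−kψ(1/2;p)}`"), held arXiv text chunk p. 5 L105–108] -/
theorem IsCenter.le_three_mul {d : E → E → ℝ} (hsymm : ∀ a b, d a b = d b a)
    (htri : ∀ a b c, d a c ≤ d a b + d b c) {x : Fin q → E} {i : Fin q} (hc : IsCenter d x i)
    {z : E} {ε : ℝ} (hgood : q < 2 * (univ.filter fun j : Fin q => d (x j) z ≤ ε).card) :
    d (x i) z ≤ 3 * ε := by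
  classical
  set G : Finset (Fin q) := univ.filter fun j : Fin q => d (x j) z ≤ ε with hG
  have hGne : G.Nonempty := by rw [← card_pos]; omega
  obtain ⟨j₀, hj₀⟩ := hGne
  -- the good majority lies within `2ε` of the good point `x j₀`
  have hsub : G ⊆ univ.filter fun j : Fin q => d (x j₀) (x j) ≤ 2 * ε := fun j hj =>
    mem_filter.2 ⟨mem_univ _,
      calc d (x j₀) (x j) ≤ d (x j₀) z + d z (x j) := htri _ _ _
        _ ≤ ε + ε := add_le_add (mem_filter.1 hj₀).2 (by rw [hsymm]; exact (mem_filter.1 hj).2)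
        _ = 2 * ε := by ring⟩
  have h1 : q < 2 * nearCount d x (x j₀) (2 * ε) := by
    have := card_le_card hsub; unfold nearCount; omega
  -- hence a strict majority lies within `2ε` of the centre; two strict majorities intersect
  set B : Finset (Fin q) := univ.filter fun j : Fin q => d (x i) (x j) ≤ 2 * ε with hB
  have h2 : q < 2 * B.card := hc (2 * ε) ⟨j₀, h1⟩
  have hinter : (B ∩ G).Nonempty := by
    rw [← card_pos]
    have hu : (B ∪ G).card ≤ q := (card_le_univ _).trans_eq (Fintype.card_fin q)
    have hsum := card_union_add_card_inter B G
    omega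
  obtain ⟨j, hj⟩ := hinter
  rw [mem_inter] at hj
  calc d (x i) z ≤ d (x i) (x j) + d (x j) z := htri _ _ _
    _ ≤ 2 * ε + ε := add_le_add (mem_filter.1 hj.1).2 (mem_filter.1 hj.2).2
    _ = 3 * ε := by ring

/-! ### §2 Boosting: `q` independent trials, per-trial failure `≤ ¼`, any centre selector -/

variable [Fintype α]

/-- **Exponential boosting by centre selection (product-weight form).**  A trial has finitely many
outcomes `a : α` with probability weights `w` and yields the estimate `pt a : E` of a target `z`;
if the per-trial mass of `{ε < d (pt a) z}` is `≤ ¼`, then over `q ≥ 1` independent trials the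
product mass of the outcome sequences whose centre-selected estimate is farther than `3ε` from
`z` is `≤ e^{−q/8}`, for ANY selector `sel` returning a centre (off the tree's Hoeffding event
`{q ≤ 2·#bad trials}` a strict majority of the estimates is within `ε` of `z`, and
`IsCenter.le_three_mul` applies). [cite: Minsker2015, §3 display `Pr(‖μ̃ − μ‖ > 3ε) ≤
e^{−kψ(1/2;p)}` with Remark 3.2, held arXiv text chunk p. 5 L105–116; JerrumValiantVazirani1986,
Lemma 6.1 (powering; the count bound is the tree's `sum_weight_half_bad_le_exp`)] -/
theorem sum_weight_center_far_le_exp (w : α → ℝ) (hw : ∀ a, 0 ≤ w a) (hw1 : ∑ a, w a = 1)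
    {d : E → E → ℝ} (hsymm : ∀ a b, d a b = d b a) (htri : ∀ a b c, d a c ≤ d a b + d b c)
    (pt : α → E) (z : E) {ε : ℝ}
    (hbad : ∑ a ∈ univ.filter (fun a : α => ε < d (pt a) z), w a ≤ 1 / 4) (hq : 0 < q)
    (sel : (Fin q → α) → Fin q) (hsel : ∀ ω, IsCenter d (fun i => pt (ω i)) (sel ω)) :
    ∑ ω ∈ univ.filter (fun ω : Fin q → α => 3 * ε < d (pt (ω (sel ω))) z), ∏ i, w (ω i) ≤
      Real.exp (-(q : ℝ) / 8) := by
  classical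
  refine le_trans (sum_le_sum_of_subset_of_nonneg (fun ω hω => ?_)
    (fun ω _ _ => prod_nonneg fun i _ => hw _))
    (Complexity.sum_weight_half_bad_le_exp w hw hw1 (fun a : α => ε < d (pt a) z) hbad hq)
  refine mem_filter.2 ⟨mem_univ _, ?_⟩
  by_contra hlt
  rw [not_le] at hlt
  -- fewer than half the trials are bad: a strict majority of the estimates is within `ε` of `z`
  have hsplit := card_filter_add_card_filter_not (s := (univ : Finset (Fin q)))
    (fun i : Fin q => ε < d (pt (ω i)) z)
  rw [card_univ, Fintype.card_fin,
    show (univ.filter fun j : Fin q => ¬ (ε < d (pt (ω j)) z)) =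
      univ.filter fun j : Fin q => d (pt (ω j)) z ≤ ε from filter_congr fun j _ => not_lt] at hsplit
  have hgood : q < 2 * (univ.filter fun j : Fin q => d (pt (ω j)) z ≤ ε).card := by omega
  exact absurd ((hsel ω).le_three_mul hsymm htri hgood) (not_le.2 (mem_filter.1 hω).2)

/-- **Confidence form.**  Under the hypotheses of `sum_weight_center_far_le_exp` and with
`q ≥ 8 ln(1/δ)` trials (`δ > 0`), the outcome sequences whose centre-selected estimate is within
`3ε` of the target carry product mass `≥ 1 − δ`. [cite: Minsker2015, §3 with Remark 3.2] -/
theorem sum_weight_center_near_ge (w : α → ℝ) (hw : ∀ a, 0 ≤ w a) (hw1 : ∑ a, w a = 1)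
    {d : E → E → ℝ} (hsymm : ∀ a b, d a b = d b a) (htri : ∀ a b c, d a c ≤ d a b + d b c)
    (pt : α → E) (z : E) {ε : ℝ}
    (hbad : ∑ a ∈ univ.filter (fun a : α => ε < d (pt a) z), w a ≤ 1 / 4) (hq : 0 < q)
    (sel : (Fin q → α) → Fin q) (hsel : ∀ ω, IsCenter d (fun i => pt (ω i)) (sel ω))
    {δ : ℝ} (hδ : 0 < δ) (hqδ : 8 * Real.log (1 / δ) ≤ q) :
    1 - δ ≤ ∑ ω ∈ univ.filter (fun ω : Fin q → α => d (pt (ω (sel ω))) z ≤ 3 * ε),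
      ∏ i, w (ω i) := by
  classical
  have hfar := (sum_weight_center_far_le_exp w hw hw1 hsymm htri pt z hbad hq sel hsel).trans
    (Complexity.exp_neg_div_eight_le hδ hqδ)
  have hsplit := sum_filter_add_sum_filter_not (univ : Finset (Fin q → α))
    (fun ω : Fin q → α => d (pt (ω (sel ω))) z ≤ 3 * ε) (fun ω => ∏ i, w (ω i))
  rw [show (univ.filter fun ω : Fin q → α => ¬ (d (pt (ω (sel ω))) z ≤ 3 * ε)) =
      univ.filter fun ω : Fin q → α => 3 * ε < d (pt (ω (sel ω))) z from
    filter_congr fun ω _ => not_le, show ∑ ω : Fin q → α, ∏ i, w (ω i) = 1 from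
    sum_iidWeight (s := q) hw1] at hsplit
  linarith

end center

/-! ### §3 One-sided approximate matrix products, boosted (Frobenius distance) -/

section frobenius

variable {m n c σ q : ℕ}

/-- `ℓ²` Minkowski on a finite index type, `√Σ(f+g)² ≤ √Σf² + √Σg²` (Cauchy–Schwarz). [folklore] -/
private theorem sqrt_sum_sq_add_le {ι : Type*} [Fintype ι] (f g : ι → ℝ) :
    Real.sqrt (∑ i, (f i + g i) ^ 2) ≤ Real.sqrt (∑ i, f i ^ 2) + Real.sqrt (∑ i, g i ^ 2) := by
  have hf := Real.sqrt_nonneg (∑ i, f i ^ 2)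
  have hg := Real.sqrt_nonneg (∑ i, g i ^ 2)
  rw [Real.sqrt_le_left (by positivity)]
  have hcs : ∑ i, f i * g i ≤ Real.sqrt (∑ i, f i ^ 2) * Real.sqrt (∑ i, g i ^ 2) :=
    Real.sum_mul_le_sqrt_mul_sqrt univ f g
  have hexp : ∑ i, (f i + g i) ^ 2 = ∑ i, f i ^ 2 + 2 * ∑ i, f i * g i + ∑ i, g i ^ 2 := by
    simp only [add_sq, sum_add_distrib, mul_sum]
    ring_nf
  rw [hexp, add_sq, Real.sq_sqrt (by positivity), Real.sq_sqrt (by positivity)]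
  nlinarith

/-- **Frobenius distance** `d_F(M, N) = ‖M − N‖_F = √frobSq (M − N)`, an explicit two-argument
function (no norm instance). [cite: ChiaEtAl2022, §2.1 notation (`‖·‖_F`); §3.2 (Frobenius error
of approximate matrix products)] -/
def frobDist (M N : Matrix (Fin n) (Fin c) ℝ) : ℝ := Real.sqrt (frobSq (M - N))

/-- `d_F` is symmetric. [cite: ChiaEtAl2022, §2.1 notation (`‖·‖_F` is a norm)] -/
theorem frobDist_comm (M N : Matrix (Fin n) (Fin c) ℝ) : frobDist M N = frobDist N M := by
  unfold frobDist
  congr 1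
  simp only [frobSq, normSq, Matrix.sub_apply]
  exact sum_congr rfl fun i _ => sum_congr rfl fun j _ => by ring

/-- `d_F` satisfies the triangle inequality (`ℓ²` Minkowski on the `n·c` entries).
[cite: ChiaEtAl2022, §2.1 notation (`‖·‖_F` is a norm)] -/
theorem frobDist_triangle (M N P : Matrix (Fin n) (Fin c) ℝ) :
    frobDist M P ≤ frobDist M N + frobDist N P := by
  have key : ∀ A B : Matrix (Fin n) (Fin c) ℝ,
      Real.sqrt (frobSq (A + B)) ≤ Real.sqrt (frobSq A) + Real.sqrt (frobSq B) := fun A B => by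
    have h := sqrt_sum_sq_add_le (fun ij : Fin n × Fin c => A ij.1 ij.2)
      (fun ij : Fin n × Fin c => B ij.1 ij.2)
    simp only [frobSq_eq_sum_sq, Matrix.add_apply, ← Fintype.sum_prod_type'] at h ⊢
    exact h
  unfold frobDist
  rw [show M - P = (M - N) + (N - P) by abel]
  exact key _ _

variable {φ : ℝ} {p : Fin m → ℝ} {X : Matrix (Fin m) (Fin n) ℝ}

/-- **Per-copy failure `≤ ¼` (one-sided Chebyshev).**  Sampling from the rows of `X` ONLY (`p` a
`φ`-oversampled row-norm distribution of `X`; `Y` arbitrary): `σ ≥ 4φ‖X‖_F²‖Y‖_F²/ε²` rows give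
`mass{ ε < ‖XᵀSᵀSY − XᵀY‖_F } ≤ ¼` (tree `iid_mass_frobSq_sub_ge_le` at `a = ε²`).
[cite: ChiaEtAl2022, §3.2 (with Chebyshev); DrineasKannanMahoney2006, App. A.3 Lemma 8] -/
theorem iid_mass_frobDist_gt_le_quarter (h : IsOversampledDist φ (rowNorms X) p) (hφ : 0 < φ)
    (hσ : σ ≠ 0) (Y : Matrix (Fin m) (Fin c) ℝ) {ε : ℝ} (hε : 0 < ε)
    (hσL : 4 * φ * (frobSq X * frobSq Y) / ε ^ 2 ≤ σ) :
    ∑ ω₁ ∈ univ.filter (fun ω₁ : Fin σ → Fin m =>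
        ε < frobDist ((sketch p ω₁ * X)ᵀ * (sketch p ω₁ * Y)) (Xᵀ * Y)), iidWeight p ω₁ ≤
      1 / 4 := by
  have hσpos : (0 : ℝ) < σ := by exact_mod_cast Nat.pos_of_ne_zero hσ
  refine ((sum_le_sum_of_subset_of_nonneg (fun ω₁ hω₁ => mem_filter.2 ⟨mem_univ _,
      ((Real.lt_sqrt hε.le).1 (mem_filter.1 hω₁).2).le⟩)
    (fun ω₁ _ _ => iidWeight_nonneg h.nonneg ω₁)).trans
    (iid_mass_frobSq_sub_ge_le h hφ hσ Y (a := ε ^ 2) (by positivity))).trans ?_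
  have h4 : 4 * φ * (frobSq X * frobSq Y) ≤ σ * ε ^ 2 := (div_le_iff₀ (by positivity)).1 hσL
  rw [div_mul_eq_mul_div, div_div, div_le_iff₀ (by positivity)]
  linarith

/-- **One-sided approximate matrix product at `log(1/δ)` cost.**  `σ ≥ 4φ‖X‖_F²‖Y‖_F²/ε²` rows per
copy (sampled from the rows of `X` only), `q ≥ 8 ln(1/δ)` independent copies (product weight
`iidWeight (iidWeight p)`), any Frobenius-centre selector: the selected copy — itself one plain
sketch product — satisfies `‖(S_*X)ᵀ(S_*Y) − XᵀY‖_F ≤ 3ε` with product mass `≥ 1 − δ`, in place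
of the one-copy Chebyshev count `σ ≥ φ‖X‖_F²‖Y‖_F²/(ε²δ)`.  (The print's Prop. "appr-mms"
reaches `log(1/δ)` by joint sampling from both factors instead — module docstring, Scope (ii).)
[cite: Minsker2015, §3 Remark 3.2, held arXiv text chunk p. 5 L105–116; ChiaEtAl2022, §3.2 (the
one-sided sketch `XᵀSᵀSY`)] -/
theorem approx_matrix_product_center (h : IsOversampledDist φ (rowNorms X) p) (hφ : 0 < φ)
    (hσ : σ ≠ 0) (Y : Matrix (Fin m) (Fin c) ℝ) {ε : ℝ} (hε : 0 < ε)
    (hσL : 4 * φ * (frobSq X * frobSq Y) / ε ^ 2 ≤ σ) (hq : 0 < q)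
    (sel : (Fin q → (Fin σ → Fin m)) → Fin q)
    (hsel : ∀ ω, IsCenter frobDist
      (fun i => (sketch p (ω i) * X)ᵀ * (sketch p (ω i) * Y)) (sel ω))
    {δ : ℝ} (hδ : 0 < δ) (hqδ : 8 * Real.log (1 / δ) ≤ q) :
    1 - δ ≤ ∑ ω ∈ univ.filter (fun ω : Fin q → (Fin σ → Fin m) =>
        frobDist ((sketch p (ω (sel ω)) * X)ᵀ * (sketch p (ω (sel ω)) * Y)) (Xᵀ * Y) ≤ 3 * ε),
      iidWeight (iidWeight p) ω :=
  sum_weight_center_near_ge (iidWeight p) (iidWeight_nonneg h.nonneg)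
    (sum_iidWeight h.sum_eq_one) frobDist_comm frobDist_triangle
    (fun ω₁ : Fin σ → Fin m => (sketch p ω₁ * X)ᵀ * (sketch p ω₁ * Y)) (Xᵀ * Y)
    (iid_mass_frobDist_gt_le_quarter h hφ hσ Y hε hσL) hq sel hsel hδ hqδ

end frobenius

end Literature.Computability.QuantumComplexity.SampleQuery

/-! ### §4 The `u ≈ Rb` step of CGLLTW Theorem 3.4, boosted, and the output join -/

namespace Literature.Computability.QuantumComplexity.SampleQuery.EvenPolySVT.Output

variable {n s σ q : ℕ}

/-- **`ℓ²` distance** `d(u, v) = ‖u − v‖ = √normSq (u − v)`, an explicit two-argument function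
(`Fin s → ℝ` carries Mathlib's sup-norm instance, not the print's norm).
[cite: ChiaEtAl2022, §3.3 proof of Theorem 3.4 (`‖Rb − u‖`)] -/
def vecDist (u v : Fin s → ℝ) : ℝ := Real.sqrt (normSq (u - v))

/-- `‖u − v‖ = ‖v − u‖`. [cite: ChiaEtAl2022, §2.1 notation (`‖·‖` is a norm)] -/
theorem vecDist_comm (u v : Fin s → ℝ) : vecDist u v = vecDist v u := by
  unfold vecDist
  congr 1
  simp only [normSq, Pi.sub_apply]
  exact sum_congr rfl fun i _ => by ring

/-- `‖u − w‖ ≤ ‖u − v‖ + ‖v − w‖` (the column instance of `frobDist_triangle`).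
[cite: ChiaEtAl2022, §2.1 notation (`‖·‖` is a norm)] -/
theorem vecDist_triangle (u v w : Fin s → ℝ) : vecDist u w ≤ vecDist u v + vecDist v w := by
  have hcol : ∀ a b : Fin s → ℝ, frobDist (colOf a) (colOf b) = vecDist a b := fun a b => by
    unfold frobDist vecDist frobSq normSq colOf
    simp
  simpa only [hcol] using frobDist_triangle (colOf u) (colOf v) (colOf w)

/-- **Per-copy failure `≤ ¼` for `u ≈ Rb`.**  `σ ≥ 4φ_b‖R‖_F²‖b‖²/ε²` indices sampled from the
witness distribution of `SQ_{φ_b}(b)` (`b ≠ 0`): `mass{ ε < ‖u − Rb‖ } ≤ ¼` — the tree's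
`iid_mass_normSq_matVecEst_sub_ge_le` at `a = ε²`. [cite: ChiaEtAl2022, §3.3 proof of Theorem
3.4 ("We further approximate `Rb ≈ u`"), held arXiv text p. 21 L10–11] -/
theorem iid_mass_matVecEst_far_le_quarter {φb : ℝ} {b : Fin n → ℝ} (wb : OversamplingWitness φb b)
    (hb : b ≠ 0) (hσ : σ ≠ 0) (R : Matrix (Fin s) (Fin n) ℝ) {ε : ℝ} (hε : 0 < ε)
    (hσL : 4 * φb * (frobSq R * normSq b) / ε ^ 2 ≤ σ) :
    ∑ ω' ∈ univ.filter (fun ω' : Fin σ → Fin n =>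
        ε < vecDist (matVecEst R b (lengthSqDist wb.tilde) ω') (R *ᵥ b)),
      iidWeight (lengthSqDist wb.tilde) ω' ≤ 1 / 4 := by
  have hσpos : (0 : ℝ) < σ := by exact_mod_cast Nat.pos_of_ne_zero hσ
  have hφb : 0 < φb := wb.pos hb
  refine ((sum_le_sum_of_subset_of_nonneg (fun ω' hω' => mem_filter.2 ⟨mem_univ _,
      ((Real.lt_sqrt hε.le).1 (mem_filter.1 hω').2).le⟩)
    (fun ω' _ _ => iidWeight_nonneg (wb.isOversampledDist hb).nonneg ω')).trans
    (iid_mass_normSq_matVecEst_sub_ge_le wb hb hσ R (a := ε ^ 2) (by positivity))).trans ?_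
  have h4 : 4 * φb * (frobSq R * normSq b) ≤ σ * ε ^ 2 := (div_le_iff₀ (by positivity)).1 hσL
  rw [div_mul_eq_mul_div, div_div, div_le_iff₀ (by positivity)]
  linarith

/-- **`u ≈ Rb` at `log(1/δ)` cost.**  `σ ≥ 4φ_b‖R‖_F²‖b‖²/ε²` samples per copy, `q ≥ 8 ln(1/δ)`
independent copies of `matVecEst`, any `ℓ²`-centre selector: the selected `u_*` has
`‖u_* − Rb‖ ≤ 3ε` with product mass `≥ 1 − δ` (access: `SQ_{φ_b}(b)` only). [cite: Minsker2015, §3]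
[cite: ChiaEtAl2022, §3.3 proof of Theorem 3.4 (the `u ≈ Rb` step)] -/
theorem matVecEst_center_near_ge {φb : ℝ} {b : Fin n → ℝ} (wb : OversamplingWitness φb b)
    (hb : b ≠ 0) (hσ : σ ≠ 0) (R : Matrix (Fin s) (Fin n) ℝ) {ε : ℝ} (hε : 0 < ε)
    (hσL : 4 * φb * (frobSq R * normSq b) / ε ^ 2 ≤ σ) (hq : 0 < q)
    (sel : (Fin q → (Fin σ → Fin n)) → Fin q)
    (hsel : ∀ ω, IsCenter vecDist (fun i => matVecEst R b (lengthSqDist wb.tilde) (ω i)) (sel ω))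
    {δ : ℝ} (hδ : 0 < δ) (hqδ : 8 * Real.log (1 / δ) ≤ q) :
    1 - δ ≤ ∑ ω ∈ univ.filter (fun ω : Fin q → (Fin σ → Fin n) =>
        vecDist (matVecEst R b (lengthSqDist wb.tilde) (ω (sel ω))) (R *ᵥ b) ≤ 3 * ε),
      iidWeight (iidWeight (lengthSqDist wb.tilde)) ω :=
  sum_weight_center_near_ge (iidWeight (lengthSqDist wb.tilde))
    (iidWeight_nonneg (wb.isOversampledDist hb).nonneg)
    (sum_iidWeight (wb.isOversampledDist hb).sum_eq_one) vecDist_comm vecDist_triangle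
    (fun ω' : Fin σ → Fin n => matVecEst R b (lengthSqDist wb.tilde) ω') (R *ᵥ b)
    (iid_mass_matVecEst_far_le_quarter wb hb hσ R hε hσL) hq sel hsel hδ hqδ

/-- **The boosted `u ≈ Rb` step joined to the output error (CGLLTW Thm 3.4, even case, vector
step, at `log(1/δ')` cost).**  For ANY `R : s × n`, `M : s × s`, scalar `c`, target `F`,
`SQ_{φ_b}(b)` with `b ≠ 0`, `η > 0`, `δ' > 0`: with **`σ ≥ 36φ_b‖R‖_F²‖RᵀM‖_F²/η²`** samples per
copy, **`q ≥ 8 ln(1/δ')`** independent copies and any `ℓ²`-centre selector, the selected copy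
`u_*` satisfies `‖(RᵀMu_* + c·b) − Fb‖ ≤ ‖RᵀMR + cI − F‖_F·‖b‖ + η·‖b‖` with product mass
`≥ 1 − δ'` — the conclusion of the tree's one-copy `output_error_mass` (there
`σ ≥ φ_b‖R‖_F²‖RᵀM‖_F²/(η²δ')`).  Proof: `matVecEst_center_near_ge` at `ε = η‖b‖/(3‖RᵀM‖_F)`,
then `output_error_le` BY NAME; if `RᵀM = 0` the event is sure.  `u_*` is ONE `matVecEst`, so
the tree's `outputWitness` (Lemma "sample-Mv" at `s + 1` terms) applies to the output verbatim.
[cite: ChiaEtAl2022, §3.3 proof of Theorem 3.4 ("We further approximate `Rb ≈ u` … This suffices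
to maintain the error bound"), held arXiv text p. 21 L10–13; Minsker2015, §3 Remark 3.2] -/
theorem output_error_mass_center {φb : ℝ} {b : Fin n → ℝ} (wb : OversamplingWitness φb b)
    (hb : b ≠ 0) (hσ : 0 < σ) (R : Matrix (Fin s) (Fin n) ℝ) (M : Matrix (Fin s) (Fin s) ℝ)
    (F : Matrix (Fin n) (Fin n) ℝ) (c : ℝ) {η δ' : ℝ} (hη : 0 < η) (hδ' : 0 < δ')
    (hσL : 36 * φb * frobSq R * frobSq (Rᵀ * M) / η ^ 2 ≤ σ) (hq : 0 < q)
    (hqδ : 8 * Real.log (1 / δ') ≤ q) (sel : (Fin q → (Fin σ → Fin n)) → Fin q)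
    (hsel : ∀ ω, IsCenter vecDist (fun i => matVecEst R b (lengthSqDist wb.tilde) (ω i)) (sel ω)) :
    1 - δ' ≤
      ∑ ω ∈ univ.filter (fun ω : Fin q → (Fin σ → Fin n) =>
          Real.sqrt (normSq (Rᵀ *ᵥ (M *ᵥ matVecEst R b (lengthSqDist wb.tilde) (ω (sel ω))) +
              c • b - F *ᵥ b)) ≤
            Real.sqrt (frobSq (Rᵀ * M * R + c • (1 : Matrix (Fin n) (Fin n) ℝ) - F)) *
                Real.sqrt (normSq b) +
              η * Real.sqrt (normSq b)),
        iidWeight (iidWeight (lengthSqDist wb.tilde)) ω := by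
  classical
  set p := lengthSqDist wb.tilde with hp
  have hdist := wb.isOversampledDist hb
  have hW0 : ∀ ω : Fin q → (Fin σ → Fin n), 0 ≤ iidWeight (iidWeight p) ω :=
    iidWeight_nonneg (iidWeight_nonneg hdist.nonneg)
  have hbpos : 0 < normSq b := normSq_pos hb
  have hφb : 0 < φb := wb.pos hb
  -- the case `RᵀM = 0`: the second error term vanishes and the event is sure
  rcases eq_or_ne (frobSq (Rᵀ * M)) 0 with h0 | h0
  · have hRM : Rᵀ * M = 0 := by
      by_contra hne
      exact (frobSq_pos hne).ne' h0
    rw [filter_true_of_mem fun ω _ => ?_, sum_iidWeight (sum_iidWeight hdist.sum_eq_one)]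
    · linarith
    refine (output_error_le R M F _ c b).trans ?_
    rw [hRM, show frobSq (0 : Matrix (Fin n) (Fin s) ℝ) = 0 by unfold frobSq normSq; simp,
      Real.sqrt_zero, zero_mul, add_zero]
    exact le_add_of_nonneg_right (by positivity)
  -- the main case: `ε = η‖b‖/(3‖RᵀM‖_F)`; then `4φ_b‖R‖_F²‖b‖²/ε² = 36φ_b‖R‖_F²‖RᵀM‖_F²/η²`
  have hRMpos : 0 < frobSq (Rᵀ * M) := lt_of_le_of_ne (frobSq_nonneg _) (Ne.symm h0)
  have hsqRM : 0 < Real.sqrt (frobSq (Rᵀ * M)) := Real.sqrt_pos.2 hRMpos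
  have hsqb : 0 < Real.sqrt (normSq b) := Real.sqrt_pos.2 hbpos
  set ε : ℝ := η * Real.sqrt (normSq b) / (3 * Real.sqrt (frobSq (Rᵀ * M))) with hε
  have hεpos : 0 < ε := by positivity
  have hσL' : 4 * φb * (frobSq R * normSq b) / ε ^ 2 ≤ σ := by
    have hε2 : ε ^ 2 = η ^ 2 * normSq b / (9 * frobSq (Rᵀ * M)) := by
      rw [hε, div_pow, mul_pow, mul_pow, Real.sq_sqrt hbpos.le, Real.sq_sqrt hRMpos.le]
      norm_num
    rw [hε2, show 4 * φb * (frobSq R * normSq b) / (η ^ 2 * normSq b / (9 * frobSq (Rᵀ * M))) =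
      36 * φb * frobSq R * frobSq (Rᵀ * M) / η ^ 2 by field_simp; ring]
    exact hσL
  refine (matVecEst_center_near_ge wb hb (Nat.pos_iff_ne_zero.mp hσ) R hεpos hσL' hq sel hsel
    hδ' hqδ).trans (sum_le_sum_of_subset_of_nonneg (fun ω hω => mem_filter.2 ⟨mem_univ _, ?_⟩)
    (fun ω _ _ => hW0 ω))
  -- on `‖u_* − Rb‖ ≤ 3ε`: `‖RᵀM‖_F·‖u_* − Rb‖ ≤ ‖RᵀM‖_F·3ε = η‖b‖`
  have hle : vecDist (matVecEst R b p (ω (sel ω))) (R *ᵥ b) ≤ 3 * ε := (mem_filter.1 hω).2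
  have h3ε : Real.sqrt (frobSq (Rᵀ * M)) * (3 * ε) = η * Real.sqrt (normSq b) := by
    rw [hε]; field_simp
  exact (output_error_le R M F _ c b).trans
    (add_le_add le_rfl (by rw [← h3ε]; exact mul_le_mul_of_nonneg_left hle hsqRM.le))

end Literature.Computability.QuantumComplexity.SampleQuery.EvenPolySVT.Output
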